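/-
Copyright (c) 2026. All rights reserved.
Released under Apache 2.0 license as described in the file LICENSE.
Authors: hodgecm-mathlib cell (D-0151), fan A, seat A-p10.
-/
import Literature.RepresentationTheory.HeisenbergGroup.SymplecticSiegelGenerationBigCell
import Mathlib.LinearAlgebra.Matrix.Transvection
import Mathlib.LinearAlgebra.Matrix.SpecialLinearGroup
import Mathlib.LinearAlgebra.Matrix.NonsingularInverse
import Mathlib.GroupTheory.Abelianization.Defs
import HarnessLib

/-!
# `Sp_{2l}(R)` has no characters for a commutative RING `R` with `2, 3 ∈ Rˣ`, the big-cell shift property and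
# elementary generation of `SL_l(R)` (Folland 1989 Prop. (4.21), ring form; the adelic case is the sequel)

Topic `RepresentationTheory/HeisenbergGroup`; namespace `Literature.RepresentationTheory.HeisenbergGroup.SymplecticMatrix`
(continuation of `SymplecticAbelianization` and `SymplecticSiegelGenerationBigCell`).  KERNEL ONLY: theorems; no
definition, no named fact, no instance, no `sorry`.

`SymplecticAbelianization` proves that every homomorphism from Mathlib's `Matrix.symplecticGroup l 𝕜` to a commutative
group is trivial for a FIELD `𝕜` of characteristic `0` ([Folland1989, §4.1 Prop. (4.21)], algebraic form).  Its proof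
uses the field structure at exactly three places: (i) `2` and `3` are invertible (`χ(n(b)) = 1` because
`m(2) n(b) m(2)⁻¹ = n(4b)`, and the transvection trick `d t d⁻¹ = t²` with `d = diag(…, 2, …)`); (ii) Siegel generation
`Sp_{2l}(𝕜) = ⟨m(a), n(b), J⟩` (`hom_ext`, local rings); (iii) Mathlib's `diagonal_transvection_induction_of_det_ne_zero`
(Gaussian elimination over a field) to reach every Levi element `m(a)`, `a ∈ GL_l(𝕜)`.  This file removes the field:

* **`hom_eq_one_of_bigCellReachable`** — for ANY commutative ring `R` with `IsUnit (2 : R)`, `IsUnit (3 : R)`, the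
  BIG-CELL SHIFT PROPERTY of `SymplecticSiegelGenerationBigCell` (hypothesis `hR`, inline: every symplectic
  `fromBlocks A B C D` admits a symmetric `X` with `A + X C` invertible — local rings, products, restricted products,
  the adele ring of a number field) and ELEMENTARY GENERATION OF `SL_l(R)` (hypothesis `hSL`, inline: every subgroup of
  `SL_l(R)` containing all transvections `1 + c E_{ij}` is everything — the conclusion of the tree's
  `Automorphic/StrongApproximationSLn :: SLnElementary.eq_top_of_transvection_mem`, available for local rings and
  (finite) adele rings), **every homomorphism `χ : Sp_{2l}(R) →* A` to a commutative group is `1`**;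
  `hom_eq_one_apply_of_bigCellReachable`, `hom_eq_one_of_surjective_of_bigCellReachable` (through any surjection),
  **`commutator_eq_top_of_bigCellReachable`** (`Sp_{2l}(R)` is perfect).
* the generator lemmas in ring form (§§1–3): `map_unip_eq_one_of_isUnit`, `map_low_eq_one_of_isUnit`,
  `map_J_eq_one_of_isUnit`, `map_levi_eq_one_of_isSymm_of_isUnit` (need only `2, 3 ∈ Rˣ`), and
  `map_levi_eq_one_of_isUnit` (needs `hSL`): the Levi factor is handled WITHOUT Gaussian elimination in `GL_l` by
  writing `a = d · s`, `d = diag(det a, 1, …, 1)` (symmetric, killed by Klingen's identity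
  `n(−s) v(s⁻¹) n(−s) = m(s) J`) and `s ∈ SL_l(R)` (killed on transvections by the `d t d⁻¹ = t²` trick, hence on
  all of `SL_l(R)` by `hSL`).

The case of use is the sequel `Literature/NumberTheory/Automorphic/AdeleRingSymplecticPerfect`: `R = 𝐀_F` the adele
ring of a number field (`2, 3 ∈ Fˣ ⊂ 𝐀_Fˣ`; big-cell shift by `bigCellReachable_adeleRing`; `hSL` by row reduction with
unit pivots place by place), whence **`Sp_{2l}(𝐀_F)` has no characters as an ABSTRACT group** — the input of the
uniqueness of metaplectic implementer comparisons over the whole adelic symplectic group (no continuity, no density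
argument), consumed in the shape `(hH : ∀ χ : H →* ℂˣ, χ = 1)` of the tree's
`Weil1964/AdelicMetaplecticRationalSectionUnique :: adelicMpCont.eq_of_proj_eq_of_forall_hom_eq_one`.

Scope (stated, not hidden): nothing here needs `R` to be a field or reduced; `2, 3 ∈ Rˣ` is used as displayed (for a
field: characteristic `≠ 2, 3`; the sharper field statement «`Sp_{2l}(K)` perfect unless `K = F₂, F₃` with small `l`» is
the tree's `SymplecticGroupNormalSubgroups.commutator_symplecticGroup_eq_top_of_sq_ne_one`, by transvections, and is not
reproved); `hSL` is a hypothesis, discharged elsewhere.  Cell `hodgecm-mathlib` (D-0151), FLOOR-0 programme P4, ENGINE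
E-2 child line `Cruxes/H413/Lines/F0_E2SiegelWeilWeilRange.lean`, stub `stub_SW0_diagChar`, road (α) piece SW0a; HC_CM
is proved only modulo the printed citations until rung 0 closes.

## References
* [Folland1989] G. B. Folland, *Harmonic Analysis in Phase Space*, Ann. of Math. Stud. 122 (1989), §4.1 Prop. (4.10)
  (generators), Prop. (4.21) (no characters).
* [MoeglinVignerasWaldspurger1987] C. Mœglin, M.-F. Vignéras, J.-L. Waldspurger, LNM 1291 (1987), Chap. 2 II.1 (B),
  II.2, II.5 (generators `m`, `n`, `w`; big cell).
* [Klingen1990] H. Klingen, *Introductory lectures on Siegel modular forms* (1990), §3 Prop. 6 (the identity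
  `n(−s) v(s⁻¹) n(−s) = m(s) J`).
-/

open Matrix

namespace Literature.RepresentationTheory.HeisenbergGroup.SymplecticMatrix

variable {l : Type*} [DecidableEq l] [Fintype l] {R : Type*} [CommRing R]
variable {A : Type*} [CommGroup A]

/-! ## §0 Plumbing -/

/-- In a commutative target conjugation is invisible: `χ(g h g⁻¹) = χ(h)`. [folklore] -/
private theorem map_conj_eq' {G : Type*} [Group G] (χ : G →* A) (g h : G) : χ (g * h * g⁻¹) = χ h := by
  rw [map_mul, map_mul, map_inv, mul_right_comm, mul_inv_cancel, one_mul]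

/-- `n(b)` depends only on the matrix `b`. [folklore] -/
private theorem unip_congr' {b b' : Matrix l l R} (h : b = b') (hb : b.IsSymm) (hb' : b'.IsSymm) :
    (unip b hb : Matrix.symplecticGroup l R) = unip b' hb' := by
  subst h; rfl

/-- An element of a commutative group equal to its own square is `1`. [folklore] -/
private theorem eq_one_of_mul_self_eq {a : A} (h : a * a = a) : a = 1 := by
  rwa [mul_eq_left] at h

/-! ## §1 Unipotents are killed (`2, 3 ∈ Rˣ`) -/

/-- **`χ(n(b)) = 1`** for every symmetric `b` over a commutative ring with `2, 3 ∈ Rˣ`: conjugating `n(b')` by the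
scalar Levi element `m(2)` gives `n(4 b') = n(b') n(3 b')`, so `χ(n(3 b')) = 1`, and `b = 3 · (3⁻¹ b)`.
[cite: Folland1989, §4.1 Prop. (4.21)] [cite: MoeglinVignerasWaldspurger1987, Chap. 2 II.2] -/
theorem map_unip_eq_one_of_isUnit (h2 : IsUnit (2 : R)) (h3 : IsUnit (3 : R))
    (χ : Matrix.symplecticGroup l R →* A) (b : Matrix l l R) (hb : b.IsSymm) : χ (unip b hb) = 1 := by
  -- `χ(n(3 b')) = 1` for every symmetric `b'`
  have key : ∀ (b' : Matrix l l R) (hb' : b'.IsSymm), χ (unip ((3 : R) • b') (hb'.smul 3)) = 1 := by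
    intro b' hb'
    set a : GL l R := Matrix.GeneralLinearGroup.scalar l h2.unit with ha_def
    have ha : (a : Matrix l l R) = diagonal fun _ => (2 : R) := by
      rw [ha_def, Matrix.GeneralLinearGroup.coe_scalar, IsUnit.unit_spec, Matrix.scalar_apply]
    have hmat : (a : Matrix l l R) * b' * (a : Matrix l l R)ᵀ = b' + (3 : R) • b' := by
      rw [ha, diagonal_transpose]
      ext x y
      simp only [mul_diagonal, diagonal_mul, Matrix.add_apply, Matrix.smul_apply, smul_eq_mul]
      ring
    have h1 : χ (levi a * unip b' hb' * (levi a)⁻¹) = χ (unip b' hb') := map_conj_eq' χ _ _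
    have hsymm : ((a : Matrix l l R) * b' * (a : Matrix l l R)ᵀ).IsSymm := by
      rw [hmat]; exact hb'.add (hb'.smul 3)
    rw [levi_mul_unip_mul_levi_inv a b' hb', unip_congr' hmat hsymm (hb'.add (hb'.smul 3)),
      unip_add b' ((3 : R) • b') hb' (hb'.smul 3), map_mul, mul_eq_left] at h1
    exact h1
  -- `b = 3 • (3⁻¹ • b)`
  have hb3 : b = (3 : R) • (((h3.unit⁻¹ : Rˣ) : R) • b) := by
    rw [smul_smul, IsUnit.mul_val_inv, one_smul]
  rw [unip_congr' hb3 hb ((hb.smul _).smul 3)]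
  exact key _ (hb.smul _)

/-- **`χ(v(c)) = 1`** (`v(c) = J n(−c) J⁻¹`). [cite: Folland1989, §4.1 Prop. (4.21)] -/
theorem map_low_eq_one_of_isUnit (h2 : IsUnit (2 : R)) (h3 : IsUnit (3 : R))
    (χ : Matrix.symplecticGroup l R →* A) (c : Matrix l l R) (hc : c.IsSymm) : χ (low c hc) = 1 := by
  rw [low_eq_conj, map_conj_eq', map_unip_eq_one_of_isUnit h2 h3]

/-! ## §2 Klingen's identity over a ring; `J` and the symmetric Levi elements are killed -/

/-- The inverse of a symmetric invertible matrix is symmetric (any commutative ring). [folklore] -/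
private theorem isSymm_coe_inv' {s : GL l R} (hs : (s : Matrix l l R).IsSymm) :
    ((s⁻¹ : GL l R) : Matrix l l R).IsSymm := by
  unfold Matrix.IsSymm
  rw [Matrix.coe_units_inv, transpose_nonsing_inv, hs.eq]

/-- **Klingen's identity `n(−s) v(s⁻¹) n(−s) = m(s) J`** for `s ∈ GL_l(R)` SYMMETRIC, over any commutative ring
(both sides are `fromBlocks 0 (−s) s⁻¹ 0`; the field version is `SymplecticAbelianization.unip_mul_low_mul_unip`).
[cite: Klingen1990, §3 Prop. 6] [cite: Folland1989, §4.1 Prop. (4.10)] -/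
private theorem unip_mul_low_mul_unip_ring (s : GL l R) (hs : (s : Matrix l l R).IsSymm) :
    (unip (-(s : Matrix l l R)) hs.neg * low ((s⁻¹ : GL l R) : Matrix l l R) (isSymm_coe_inv' hs) *
        unip (-(s : Matrix l l R)) hs.neg : Matrix.symplecticGroup l R) = levi s * SymplecticGroup.symJ l R := by
  apply Subtype.ext
  simp only [coe_unip, coe_low, coe_levi, Submonoid.coe_mul, SymplecticGroup.coe_J, Matrix.J, fromBlocks_multiply,
    Matrix.mul_zero, Matrix.one_mul, add_zero, zero_add, Matrix.neg_mul, Matrix.mul_neg, mul_one, neg_zero]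
  rw [← Units.val_mul, mul_inv_cancel, Units.val_one, ← Units.val_mul, inv_mul_cancel, Units.val_one,
    (isSymm_coe_inv' hs).eq, add_neg_cancel, neg_add_cancel]
  simp only [Matrix.zero_mul, neg_zero, zero_add]

/-- **`χ(J) = 1`**: Klingen's identity at `s = 1` reads `n(−1) v(1) n(−1) = J`. [cite: Folland1989, §4.1 Prop. (4.21)] -/
theorem map_J_eq_one_of_isUnit (h2 : IsUnit (2 : R)) (h3 : IsUnit (3 : R))
    (χ : Matrix.symplecticGroup l R →* A) : χ (SymplecticGroup.symJ l R) = 1 := by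
  have h := congrArg χ (unip_mul_low_mul_unip_ring (1 : GL l R) (by rw [Units.val_one]; exact isSymm_one))
  rw [map_mul, map_mul, map_mul, map_unip_eq_one_of_isUnit h2 h3, map_low_eq_one_of_isUnit h2 h3, levi_one,
    map_one] at h
  simpa only [one_mul, mul_one] using h.symm

/-- **`χ(m(s)) = 1` for every SYMMETRIC `s ∈ GL_l(R)`.** [cite: Folland1989, §4.1 Prop. (4.21)] -/
theorem map_levi_eq_one_of_isSymm_of_isUnit (h2 : IsUnit (2 : R)) (h3 : IsUnit (3 : R))
    (χ : Matrix.symplecticGroup l R →* A) (s : GL l R) (hs : (s : Matrix l l R).IsSymm) : χ (levi s) = 1 := by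
  have h := congrArg χ (unip_mul_low_mul_unip_ring s hs)
  rw [map_mul, map_mul, map_mul, map_unip_eq_one_of_isUnit h2 h3, map_low_eq_one_of_isUnit h2 h3,
    map_J_eq_one_of_isUnit h2 h3, one_mul, one_mul, mul_one] at h
  exact h.symm

/-! ## §3 The Levi factor: `a = diag(det a, 1, …, 1) · s`, `s ∈ SL_l(R)` -/

/-- `m(a⁻¹) = m(a)⁻¹`. [folklore] -/
private theorem levi_inv' (a : GL l R) : (levi a⁻¹ : Matrix.symplecticGroup l R) = (levi a)⁻¹ := map_inv leviHom a

/-- Conjugating the transvection `1 + c E_{ij}` by `diag(1, …, u, …, 1)` (`u` at `i`, inverse `u'`) multiplies `c` by `u`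
(any commutative ring). [folklore] -/
private theorem diagonal_mul_transvection_mul_diagonal' {i j : l} (hij : i ≠ j) (c u u' : R) (huu' : u * u' = 1) :
    diagonal (Function.update 1 i u) * transvection i j c * diagonal (Function.update 1 i u') =
      transvection i j (u * c) := by
  ext a b
  simp only [transvection, mul_diagonal, diagonal_mul, Matrix.add_apply, Matrix.one_apply, Matrix.single_apply]
  by_cases hab : a = b
  · subst hab
    have h1 : ¬(i = a ∧ j = a) := fun h => hij (h.1.trans h.2.symm)
    rw [if_pos rfl, if_neg h1, if_neg h1, add_zero, mul_one]
    by_cases hai : a = i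
    · subst hai; rw [Function.update_self, Function.update_self, huu']
    · rw [Function.update_of_ne hai, Function.update_of_ne hai, Pi.one_apply, mul_one]
  · rw [if_neg hab, zero_add, zero_add]
    by_cases h : i = a ∧ j = b
    · obtain ⟨rfl, rfl⟩ := h
      rw [if_pos ⟨rfl, rfl⟩, if_pos ⟨rfl, rfl⟩, Function.update_self, Function.update_of_ne hij.symm, Pi.one_apply,
        mul_one, mul_comm]
    · rw [if_neg h, if_neg h, mul_zero, zero_mul]

/-- The invertible diagonal matrix `diag(1, …, u, …, 1)` (`u ∈ Rˣ` at `i`) as an element of `GL_l(R)`. [folklore] -/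
private theorem diagonal_update_mul_diagonal_update (i : l) (u u' : R) (huu' : u * u' = 1) :
    diagonal (Function.update (1 : l → R) i u) * diagonal (Function.update (1 : l → R) i u') = 1 := by
  rw [diagonal_mul_diagonal, ← diagonal_one]
  congr 1
  funext k
  by_cases hk : k = i
  · subst hk; rw [Function.update_self, Function.update_self, huu']
  · rw [Function.update_of_ne hk, Function.update_of_ne hk, Pi.one_apply, mul_one]

/-- `det diag(1, …, u, …, 1) = u`. [folklore] -/
private theorem det_diagonal_update_one (i : l) (u : R) : (diagonal (Function.update (1 : l → R) i u)).det = u := by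
  simp only [det_diagonal, Finset.prod_update_of_mem (Finset.mem_univ i), Pi.one_apply, Finset.prod_const_one,
    mul_one]

/-- **`χ(m(t)) = 1` for a transvection `t = 1 + c E_{ij}`** (`2 ∈ Rˣ`): `d t d⁻¹ = t²` for `d = diag(1, …, 2ᵢ, …, 1)`, so
`χ(m(t)) = χ(m(t))²`. [cite: Folland1989, §4.1 Prop. (4.21)] -/
theorem map_levi_toGL_transvection_eq_one (h2 : IsUnit (2 : R)) (χ : Matrix.symplecticGroup l R →* A)
    {i j : l} (hij : i ≠ j) (c : R) :
    χ (levi (Matrix.SpecialLinearGroup.toGL (Matrix.SpecialLinearGroup.transvection hij c))) = 1 := by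
  set u : GL l R := Matrix.SpecialLinearGroup.toGL (Matrix.SpecialLinearGroup.transvection hij c) with hu_def
  have hu : (u : Matrix l l R) = transvection i j c := rfl
  have h22 : (2 : R) * ((h2.unit⁻¹ : Rˣ) : R) = 1 := IsUnit.mul_val_inv h2
  have h22' : ((h2.unit⁻¹ : Rˣ) : R) * 2 = 1 := IsUnit.val_inv_mul h2
  let d : GL l R :=
    ⟨diagonal (Function.update (1 : l → R) i 2), diagonal (Function.update (1 : l → R) i ((h2.unit⁻¹ : Rˣ) : R)),
      diagonal_update_mul_diagonal_update i _ _ h22, diagonal_update_mul_diagonal_update i _ _ h22'⟩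
  have hconj : d * u * d⁻¹ = u * u := by
    apply Units.ext
    rw [Units.val_mul, Units.val_mul, Units.val_mul, hu, transvection_mul_transvection_same _ _ hij,
      show ((d⁻¹ : GL l R) : Matrix l l R) = diagonal (Function.update (1 : l → R) i ((h2.unit⁻¹ : Rˣ) : R)) from rfl,
      show ((d : GL l R) : Matrix l l R) = diagonal (Function.update (1 : l → R) i 2) from rfl,
      diagonal_mul_transvection_mul_diagonal' hij c 2 _ h22, two_mul]
  have h1 : χ (levi (d * u * d⁻¹)) = χ (levi u) := by
    rw [levi_mul, levi_mul, levi_inv', map_conj_eq']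
  rw [hconj, levi_mul, map_mul] at h1
  exact eq_one_of_mul_self_eq h1

/-- **`χ(m(s)) = 1` for every `s ∈ SL_l(R)`**, given elementary generation of `SL_l(R)` (`hSL`): the kernel of
`s ↦ χ(m(s))` contains every transvection. [cite: Folland1989, §4.1 Prop. (4.21)] -/
theorem map_levi_toGL_eq_one (h2 : IsUnit (2 : R))
    (hSL : ∀ H : Subgroup (Matrix.SpecialLinearGroup l R),
      (∀ (i j : l) (hij : i ≠ j) (c : R), Matrix.SpecialLinearGroup.transvection hij c ∈ H) → H = ⊤)
    (χ : Matrix.symplecticGroup l R →* A) (s : Matrix.SpecialLinearGroup l R) :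
    χ (levi (Matrix.SpecialLinearGroup.toGL s)) = 1 := by
  let ψ : Matrix.SpecialLinearGroup l R →* A := (χ.comp leviHom).comp Matrix.SpecialLinearGroup.toGL
  have hψ : ψ.ker = ⊤ := hSL ψ.ker fun i j hij c => by
    rw [MonoidHom.mem_ker]
    exact map_levi_toGL_transvection_eq_one h2 χ hij c
  have hs : s ∈ ψ.ker := by rw [hψ]; exact Subgroup.mem_top s
  rwa [MonoidHom.mem_ker] at hs

/-- **`χ(m(a)) = 1` for EVERY `a ∈ GL_l(R)`** (`2, 3 ∈ Rˣ`, elementary generation of `SL_l(R)`): `a = d · s` with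
`d = diag(1, …, det a, …, 1)` symmetric and `s = d⁻¹ a ∈ SL_l(R)`. [cite: Folland1989, §4.1 Prop. (4.21)] -/
theorem map_levi_eq_one_of_isUnit (h2 : IsUnit (2 : R)) (h3 : IsUnit (3 : R))
    (hSL : ∀ H : Subgroup (Matrix.SpecialLinearGroup l R),
      (∀ (i j : l) (hij : i ≠ j) (c : R), Matrix.SpecialLinearGroup.transvection hij c ∈ H) → H = ⊤)
    (χ : Matrix.symplecticGroup l R →* A) (a : GL l R) : χ (levi a) = 1 := by
  rcases isEmpty_or_nonempty l with hl | ⟨⟨i₀⟩⟩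
  · -- no indices: `GL_l(R)` is trivial
    have ha : a = 1 := Subsingleton.elim a 1
    rw [ha, levi_one, map_one]
  -- `d = diag(1, …, det a, …, 1)` and its inverse
  set δ : Rˣ := Matrix.GeneralLinearGroup.det a with hδ_def
  have hδδ : (δ : R) * ((δ⁻¹ : Rˣ) : R) = 1 := Units.mul_inv δ
  have hδδ' : ((δ⁻¹ : Rˣ) : R) * (δ : R) = 1 := Units.inv_mul δ
  let d : GL l R :=
    ⟨diagonal (Function.update (1 : l → R) i₀ (δ : R)), diagonal (Function.update (1 : l → R) i₀ ((δ⁻¹ : Rˣ) : R)),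
      diagonal_update_mul_diagonal_update i₀ _ _ hδδ, diagonal_update_mul_diagonal_update i₀ _ _ hδδ'⟩
  have hd : ((d : GL l R) : Matrix l l R) = diagonal (Function.update (1 : l → R) i₀ (δ : R)) := rfl
  have hdinv : ((d⁻¹ : GL l R) : Matrix l l R) = diagonal (Function.update (1 : l → R) i₀ ((δ⁻¹ : Rˣ) : R)) := rfl
  -- `s = d⁻¹ a` has determinant `1`
  have hdet : ((d⁻¹ * a : GL l R) : Matrix l l R).det = 1 := by
    rw [Units.val_mul, det_mul, hdinv, det_diagonal_update_one, hδ_def, ← Matrix.GeneralLinearGroup.val_det_apply,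
      ← Units.val_mul, inv_mul_cancel, Units.val_one]
  let s : Matrix.SpecialLinearGroup l R := ⟨((d⁻¹ * a : GL l R) : Matrix l l R), hdet⟩
  have hs : Matrix.SpecialLinearGroup.toGL s = d⁻¹ * a := Units.ext rfl
  have hsymm : ((d : GL l R) : Matrix l l R).IsSymm := by rw [hd]; exact isSymm_diagonal _
  -- `a = d · s`
  have ha : a = d * Matrix.SpecialLinearGroup.toGL s := by rw [hs, mul_inv_cancel_left]
  rw [ha, levi_mul, map_mul, map_levi_eq_one_of_isSymm_of_isUnit h2 h3 χ d hsymm, map_levi_toGL_eq_one h2 hSL,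
    one_mul]

/-! ## §4 Conclusion: no characters, perfectness -/

/-- **Every homomorphism from `Sp_{2l}(R)` to a commutative group is trivial**, for a commutative ring `R` with
`2, 3 ∈ Rˣ`, the big-cell shift property (`hR`) and elementary generation of `SL_l(R)` (`hSL`) — Folland's
Prop. (4.21) in ring form; `R` a local ring or the adele ring of a number field are the cases of record.
[cite: Folland1989, §4.1 Prop. (4.21)] [cite: MoeglinVignerasWaldspurger1987, Chap. 2 II.1 (B) and II.5] -/
theorem hom_eq_one_of_bigCellReachable
    (hR : ∀ ⦃P Q S T : Matrix l l R⦄, fromBlocks P Q S T ∈ Matrix.symplecticGroup l R →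
      ∃ X : Matrix l l R, X.IsSymm ∧ IsUnit (P + X * S).det)
    (h2 : IsUnit (2 : R)) (h3 : IsUnit (3 : R))
    (hSL : ∀ H : Subgroup (Matrix.SpecialLinearGroup l R),
      (∀ (i j : l) (hij : i ≠ j) (c : R), Matrix.SpecialLinearGroup.transvection hij c ∈ H) → H = ⊤)
    (χ : Matrix.symplecticGroup l R →* A) : χ = 1 :=
  hom_ext_of_bigCellReachable hR (fun a => by rw [map_levi_eq_one_of_isUnit h2 h3 hSL, MonoidHom.one_apply])
    (fun b hb => by rw [map_unip_eq_one_of_isUnit h2 h3, MonoidHom.one_apply])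
    (by rw [map_J_eq_one_of_isUnit h2 h3, MonoidHom.one_apply])

/-- Pointwise form of `hom_eq_one_of_bigCellReachable`. [cite: Folland1989, §4.1 Prop. (4.21)] -/
theorem hom_eq_one_apply_of_bigCellReachable
    (hR : ∀ ⦃P Q S T : Matrix l l R⦄, fromBlocks P Q S T ∈ Matrix.symplecticGroup l R →
      ∃ X : Matrix l l R, X.IsSymm ∧ IsUnit (P + X * S).det)
    (h2 : IsUnit (2 : R)) (h3 : IsUnit (3 : R))
    (hSL : ∀ H : Subgroup (Matrix.SpecialLinearGroup l R),
      (∀ (i j : l) (hij : i ≠ j) (c : R), Matrix.SpecialLinearGroup.transvection hij c ∈ H) → H = ⊤)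
    (χ : Matrix.symplecticGroup l R →* A) (g : Matrix.symplecticGroup l R) : χ g = 1 := by
  rw [hom_eq_one_of_bigCellReachable hR h2 h3 hSL χ, MonoidHom.one_apply]

/-- The same through any group receiving a surjection from `Sp_{2l}(R)` (e.g. the coordinate-free `Sp(W, β_T)` along the
tree's `transportSp`): a homomorphism to a commutative group out of such a group is trivial.
[cite: Folland1989, §4.1 Prop. (4.21)] -/
theorem hom_eq_one_of_surjective_of_bigCellReachable
    (hR : ∀ ⦃P Q S T : Matrix l l R⦄, fromBlocks P Q S T ∈ Matrix.symplecticGroup l R →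
      ∃ X : Matrix l l R, X.IsSymm ∧ IsUnit (P + X * S).det)
    (h2 : IsUnit (2 : R)) (h3 : IsUnit (3 : R))
    (hSL : ∀ H : Subgroup (Matrix.SpecialLinearGroup l R),
      (∀ (i j : l) (hij : i ≠ j) (c : R), Matrix.SpecialLinearGroup.transvection hij c ∈ H) → H = ⊤)
    {G : Type*} [Group G] (π : Matrix.symplecticGroup l R →* G) (hπ : Function.Surjective π) (χ : G →* A) :
    χ = 1 := by
  refine MonoidHom.ext fun g => ?_
  obtain ⟨x, rfl⟩ := hπ g
  rw [← MonoidHom.comp_apply, hom_eq_one_of_bigCellReachable hR h2 h3 hSL (χ.comp π), MonoidHom.one_apply,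
    MonoidHom.one_apply]

/-- **`Sp_{2l}(R)` is perfect**: its commutator subgroup is everything (the abelianisation map is a homomorphism to a
commutative group, hence trivial, and its kernel is the commutator subgroup).
[cite: Folland1989, §4.1 Prop. (4.21)] [cite: MoeglinVignerasWaldspurger1987, Chap. 2 II.1 (B)] -/
theorem commutator_eq_top_of_bigCellReachable
    (hR : ∀ ⦃P Q S T : Matrix l l R⦄, fromBlocks P Q S T ∈ Matrix.symplecticGroup l R →
      ∃ X : Matrix l l R, X.IsSymm ∧ IsUnit (P + X * S).det)
    (h2 : IsUnit (2 : R)) (h3 : IsUnit (3 : R))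
    (hSL : ∀ H : Subgroup (Matrix.SpecialLinearGroup l R),
      (∀ (i j : l) (hij : i ≠ j) (c : R), Matrix.SpecialLinearGroup.transvection hij c ∈ H) → H = ⊤) :
    commutator (Matrix.symplecticGroup l R) = ⊤ := by
  rw [← Abelianization.ker_of,
    hom_eq_one_of_bigCellReachable hR h2 h3 hSL (Abelianization.of (G := Matrix.symplecticGroup l R))]
  exact MonoidHom.ker_one

/-- Perfectness passes along surjections: a group receiving a surjection from `Sp_{2l}(R)` is perfect.
[cite: MoeglinVignerasWaldspurger1987, Chap. 2 II.1 (B)] -/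
theorem commutator_eq_top_of_surjective_of_bigCellReachable
    (hR : ∀ ⦃P Q S T : Matrix l l R⦄, fromBlocks P Q S T ∈ Matrix.symplecticGroup l R →
      ∃ X : Matrix l l R, X.IsSymm ∧ IsUnit (P + X * S).det)
    (h2 : IsUnit (2 : R)) (h3 : IsUnit (3 : R))
    (hSL : ∀ H : Subgroup (Matrix.SpecialLinearGroup l R),
      (∀ (i j : l) (hij : i ≠ j) (c : R), Matrix.SpecialLinearGroup.transvection hij c ∈ H) → H = ⊤)
    {G : Type*} [Group G] (π : Matrix.symplecticGroup l R →* G) (hπ : Function.Surjective π) :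
    commutator G = ⊤ := by
  rw [← Abelianization.ker_of,
    hom_eq_one_of_surjective_of_bigCellReachable hR h2 h3 hSL π hπ (Abelianization.of (G := G))]
  exact MonoidHom.ker_one

end Literature.RepresentationTheory.HeisenbergGroup.SymplecticMatrix
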